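import Mathlib
import HarnessLib
import Summits.MatrixMultiplication.MatrixMultiplication.Theorems.OutsiderSandwichHalfMMFinite

/-!
# OutsiderSandwich — the mixed gadget `⟨2,2,2⟩ ⊕ ⟨1⟩ ≤ cw₂^{⊠2}` (an exact `{0, ±1}` gluing)
(decomp-mm lens 4 «minimal-counterexample / extremal reduction», gen 42, kernel K42-b; THESES-FREE;
definitions = the certificate tables only, in the style of `OutsiderSandwichHalfMMFinite`)

The `N = 2` packing profile of the little Coppersmith–Winograd tensor over `{⟨2,2,2⟩, ⟨1⟩}`-sums.
In kernel before this file: `⟨6⟩ ≤ cw₂^{⊠2}` and `⟨7⟩ ≰ cw₂^{⊠2}` (`Q(cw₂^{⊠2}) = 6`,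
`OutsiderSandwichSubrankSix`), `⟨2,2,2⟩ ≤ cw₂ ⊠ ⟨2⟩ ≤ cw₂^{⊠2}` (`I(2,2)`, `OutsiderSandwichHalfMMFinite.halfMM`).
NEW here: a `2 × 2` matrix product AND a spare diagonal point fit together,

  `⟨2,2,2⟩ ⊕ ⟨1⟩ ≤ cw₂ ⊠ cw₂`  (`mmPlusPoint_le_cwSq`, hence `≤ cw₂^{⊠2}`, `mmPlusPoint_le_cwPow_two`),

by an explicit restriction whose three matrices have one entry `±1` (or none) per host column
(`gdA/gdB/gdC`, found by simulated annealing over signed gluing maps and checked entrywise over `ℤ` by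
`decide`: `125` target entries against the `81 = 9²`-point host support, `gadget_int_identity`).  The
point sits on the `A_{*0} ⊗ B_{**} ⊗ C_{0*}` block of `cw₂ ⊠ cw₂` (first letters `(i,i,0)`, second
letters `(0,j,j)`), the matrix product on the remaining blocks, and the signs cancel the cross terms —
the half-MM certificate uses only the sub-host `cw₂ ⊠ ⟨2⟩`; this one needs the whole square.

Census consequences (packings into `cw₂^{⊠N}`, restriction order).  (i) The `N = 2` profile: the
maximal certified restrictions of `cw₂^{⊠2}` among `F·⟨2,2,2⟩ ⊕ ⟨k⟩` are now `⟨6⟩` and `⟨2,2,2⟩ ⊕ ⟨1⟩`;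
`⟨7⟩` is refuted (K39-c); `2·⟨2,2,2⟩` — a cell where both pencil laws of Parts I/IIg are TIGHT — is
the target of the companion kernel K42-a of this generation (`OutsiderSandwichSegreTransport`: rank-one
cones of the blocks are carried into the minimal slice layer of `D^{⊠2}`); `⟨2,2,2⟩ ⊕ ⟨2⟩` stays open (Levenberg–Marquardt numerics, gen 42: residual `→ 0` only with diverging norms — the
signature of a degeneration that is not a restriction; no certificate either way).  (ii) Mixed cells:
`cw₂^{⊠(N+2)} ≥ (⟨2,2,2⟩ ⊕ ⟨1⟩) ⊠ cw₂^{⊠N} ≥ ⟨2,2,2⟩ ⊠ ⟨Q_N⟩ ⊕ cw₂^{⊠N}`, e.g. `7·⟨2,2,2⟩ ⊕ ⟨2⟩ ≤ cw₂^{⊠4}`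
beside the equal-block floor `7·⟨2,2,2⟩ ≤ cw₂^{⊠4}`; for the equal-block cells `F·⟨m,m,m⟩` of the
`LaserTangency` instrument the gadget is exactly one copy short of a new floor at every `N ≤ 10`
(`Q_{N-2} + F_{N-2}·… `: `(4,2)`: `6+1 = 7`, `(5,2)`: `14+3 = 17 < 18`, `(7,2)`: `102+18 = 120 < 121`).

Bearing on the cut (`closes : LaserTangency → LaserMergeOptimal → SummitIffLaserTangency → ω = 2`):
`LaserTangency` (stmt-32268, NEC·WEAKER·INSTRUMENTED) is decided by the growth of the finite packing
tables `⟨B⟩ ⊠ ⟨m,m,m⟩ ≤ cw₂^{⊠N}`; this file adds the first MIXED exact cell and, with K42-a, closes the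
`N = 2` row of the census up to the single degeneration-flavoured question `⟨2,2,2⟩ ⊕ ⟨2⟩`.

References: [cite: CoppersmithWinograd1990, §6–7]; [cite: ChristandlVranaZuiddam2023, §1.1];
[cite: BurgisserClausenShokrollahi1997, (15.25)]; [cite: Blaser2013, §5.2].
-/

set_option linter.dupNamespace false

namespace Summit.MatrixMultiplication.MatrixMultiplication.Theorems.OutsiderSandwichMMPlusPoint

open scoped BigOperators
open Literature.Computability.AlgebraicComplexity
open Summit.MatrixMultiplication.MatrixMultiplication.Theorems.OutsiderSandwichDegenerationWitness
  (cwPow_add_restrictsTo intCast_cwTensor intCast_unitTensor kroneckerPow_one_restrictsTo)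
open Summit.MatrixMultiplication.MatrixMultiplication.Theorems.OutsiderSandwichHalfMM
  (intCast_matMulTensor)

/-! ## The certificate -/

/-- Codes of the target slots: `⟨2,2,2⟩`-index `(u,v) ↦ 2u+v ∈ {0,…,3}`, the point `↦ 4`
(`5` = "dropped host coordinate"). [new] -/
def code : (Fin 2 × Fin 2) ⊕ Fin 1 → Fin 6
  | Sum.inl p => ⟨2 * p.1.val + p.2.val, by have := p.1.isLt; have := p.2.isLt; omega⟩
  | Sum.inr _ => 4

/-- slot-1 gluing map: host coordinate `(a₁,a₂) ∈ Fin 3 × Fin 3` of `cw₂ ⊠ cw₂` ↦ target code. [new] -/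
def gdTA : Fin 3 → Fin 3 → Fin 6 := ![![4,2,3], ![5,1,3], ![5,0,2]]
/-- slot-1 signs. [new] -/
def gdSA : Fin 3 → Fin 3 → ℤ := ![![-1,1,-1], ![0,-1,1], ![0,-1,1]]
/-- slot-2 gluing map. [new] -/
def gdTB : Fin 3 → Fin 3 → Fin 6 := ![![0,1,3], ![0,5,4], ![2,5,5]]
/-- slot-2 signs. [new] -/
def gdSB : Fin 3 → Fin 3 → ℤ := ![![-1,-1,1], ![-1,0,-1], ![1,0,0]]
/-- slot-3 gluing map. [new] -/
def gdTC : Fin 3 → Fin 3 → Fin 6 := ![![3,5,5], ![3,1,4], ![2,0,1]]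
/-- slot-3 signs. [new] -/
def gdSC : Fin 3 → Fin 3 → ℤ := ![![1,0,0], ![1,1,1], ![1,1,-1]]
/-- the three restriction matrices over `ℤ` (at most one `±1` per host column). [new] -/
def gdA (p : (Fin 2 × Fin 2) ⊕ Fin 1) (a : Fin 3 × Fin 3) : ℤ :=
  if gdTA a.1 a.2 = code p then gdSA a.1 a.2 else 0
/-- see `gdA`. [new] -/
def gdB (p : (Fin 2 × Fin 2) ⊕ Fin 1) (a : Fin 3 × Fin 3) : ℤ :=
  if gdTB a.1 a.2 = code p then gdSB a.1 a.2 else 0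
/-- see `gdA`. [new] -/
def gdC (p : (Fin 2 × Fin 2) ⊕ Fin 1) (a : Fin 3 × Fin 3) : ℤ :=
  if gdTC a.1 a.2 = code p then gdSC a.1 a.2 else 0

set_option maxRecDepth 8000 in
set_option maxHeartbeats 2000000 in
/-- **The gadget identity over `ℤ`**: `⟨2,2,2⟩ ⊕ ⟨1⟩ = (gdA ⊗ gdB ⊗ gdC)·(cw₂ ⊠ cw₂)` entrywise — all
`125` target entries against the `729` host triples, by `decide`. [new] -/
theorem gadget_int_identity (a' b' c' : (Fin 2 × Fin 2) ⊕ Fin 1) :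
    directSumTensor (matMulTensor ℤ 2 2 2) (unitTensor ℤ 1) a' b' c' =
      ∑ a : Fin 3 × Fin 3, ∑ b : Fin 3 × Fin 3, ∑ c : Fin 3 × Fin 3,
        gdA a' a * gdB b' b * gdC c' c * kroneckerTensor (cwTensor ℤ 2) (cwTensor ℤ 2) a b c := by
  revert b' c'
  rcases a' with ⟨u, v⟩ | w
  · fin_cases u <;> fin_cases v <;> decide
  · fin_cases w
    decide

/-- cast `ℤ → ℂ` of the target `⟨2,2,2⟩ ⊕ ⟨1⟩`. [folklore] -/
theorem intCast_target (x y z : (Fin 2 × Fin 2) ⊕ Fin 1) :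
    ((directSumTensor (matMulTensor ℤ 2 2 2) (unitTensor ℤ 1) x y z : ℤ) : ℂ) =
      directSumTensor (matMulTensor ℂ 2 2 2) (unitTensor ℂ 1) x y z := by
  rcases x with x | x <;> rcases y with y | y <;> rcases z with z | z <;>
    simp [directSumTensor, intCast_matMulTensor]

/-- **`⟨2,2,2⟩ ⊕ ⟨1⟩ ≤ cw₂ ⊠ cw₂` over `ℂ`** — an honest restriction (not a degeneration). [new] -/
theorem mmPlusPoint_le_cwSq :
    TensorRestrictsTo (kroneckerTensor (cwTensor ℂ 2) (cwTensor ℂ 2))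
      (directSumTensor (matMulTensor ℂ 2 2 2) (unitTensor ℂ 1)) := by
  refine ⟨fun p a => (gdA p a : ℂ), fun p a => (gdB p a : ℂ), fun p a => (gdC p a : ℂ),
    fun a' b' c' => ?_⟩
  have h := congrArg (fun z : ℤ => (z : ℂ)) (gadget_int_identity a' b' c')
  simpa only [Int.cast_sum, Int.cast_mul, intCast_target, kroneckerTensor_apply,
    intCast_cwTensor] using h

/-- **`⟨2,2,2⟩ ⊕ ⟨1⟩ ≤ cw₂^{⊠2}`**. [new] -/
theorem mmPlusPoint_le_cwPow_two :
    TensorRestrictsTo (kroneckerPow (cwTensor ℂ 2) 2)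
      (directSumTensor (matMulTensor ℂ 2 2 2) (unitTensor ℂ 1)) :=
  ((cwPow_add_restrictsTo 1 1).trans
    ((kroneckerPow_one_restrictsTo _).kronecker (kroneckerPow_one_restrictsTo _))).trans
    mmPlusPoint_le_cwSq

end Summit.MatrixMultiplication.MatrixMultiplication.Theorems.OutsiderSandwichMMPlusPoint
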